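import Summits.Ventures.PercRepro.PlaneCore

/-!
# PercRepro — the soft max-trace rule at `(6, 3)`: definitions and the single-witness bound (p2, gen 6)

mine-2's `MINE2-RLS.md` §19 proves C-025 at `(6, 3)` per plane with the PLANES-ONLY soft max-trace rule
`f(P, S) = 6^{|S ∩ P| − 3}` when the trace `S ∩ P` has rank `3` (and `0` otherwise), normalised by
`D(S) = Σ_P f(P, S)` over the planes `P` of `M`.  A plane `G` receives from a set `S = B ∪ X` (`B = S ∩ G` of rank `3`,
`X ⊆ E ∖ G`) the share `6^{|B| − 3} / D(S)`, so LOWER bounds on the supply of `G` need only UPPER bounds on `D(S)`.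
This file proves those bounds (the inequality halves of §19.2 Lemma S (a)/(b)/(c)) and Lemma Λ (§19.3):

* `fRule`, `D`, `Lam` — the rule, the denominator, and `Λ(B) = Σ_{L line, |L ∩ B| ≥ 2} 6^{|L ∩ B| − 2}`;
* `D_single_le`: `D(B ∪ {x}) ≤ 6^{|B| − 3} + Λ(B)` for `x ∉ G` — the planes of `M|S` other than `G` are the
  `cl(ℓ ∪ x)` over the lines `ℓ` of `M|B`, with trace `|ℓ ∩ B| + 1`;
The pair witnesses (`SixThreePair.lean`), Lemma Λ (`SixThreeLam.lean`) and the share bounds with Theorem P₂'s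
`|B| ≥ 4` step (`SixThreeShares.lean`) build on this file.  Everything is stated in `M` itself (no restriction to
`G ∪ W` is needed for these bounds).
-/

namespace PercRepro

namespace SixThree

open Finset ThmH

variable {α : Type*} [DecidableEq α] {M : Matroid α} [M.Finite]

/-- The planes-only soft max-trace rule at `q = 3` (mine-2 §19.0): a plane `P` receives `6^{|S ∩ P| − 3}` from `S`
when the trace `S ∩ P` has rank `3`, and `0` otherwise. -/
noncomputable def fRule (M : Matroid α) [M.Finite] (P S : Finset α) : ℚ :=
  if M.eRk ((S ∩ P : Finset α) : Set α) = 3 then (6 : ℚ) ^ ((S ∩ P).card - 3) else 0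

/-- The rule is nonnegative. -/
theorem fRule_nonneg (M : Matroid α) [M.Finite] (P S : Finset α) : 0 ≤ fRule M P S := by
  unfold fRule
  split_ifs <;> positivity

/-- The denominator `D(S) = Σ_{P ∈ planes M} f(P, S)`. -/
noncomputable def D (M : Matroid α) [M.Finite] (S : Finset α) : ℚ := ∑ P ∈ planes M, fRule M P S

/-- The denominator is nonnegative. -/
theorem D_nonneg (M : Matroid α) [M.Finite] (S : Finset α) : 0 ≤ D M S :=
  Finset.sum_nonneg (fun P _ => fRule_nonneg M P S)

/-- The rank-`3` subsets of `G` (`R₃(G)` of mine-2 §19.7). -/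
noncomputable def R3 (M : Matroid α) [M.Finite] (G : Finset α) : Finset (Finset α) :=
  G.powerset.filter (fun B : Finset α => M.eRk ((B : Finset α) : Set α) = 3)

/-- The lines of `M` meeting `B` in at least two points (the lines of `M|B`). -/
noncomputable def linesOf (M : Matroid α) [M.Finite] (B : Finset α) : Finset (Finset α) :=
  (lines M).filter (fun L => 2 ≤ (L ∩ B).card)

/-- `Λ(B) = Σ_{L ∈ linesOf B} 6^{|L ∩ B| − 2}` (mine-2 §19.0). -/
noncomputable def Lam (M : Matroid α) [M.Finite] (B : Finset α) : ℚ :=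
  ∑ L ∈ linesOf M B, (6 : ℚ) ^ ((L ∩ B).card - 2)

/-- The rule evaluated at the plane of the trace: `f(G, S) = 6^{|B| − 3}` when `S ∩ G = B` has rank `3`. -/
theorem fRule_eq_of_inter {G S B : Finset α} (hSG : S ∩ G = B) (hr : M.eRk (B : Set α) = 3) :
    fRule M G S = (6 : ℚ) ^ (B.card - 3) := by
  unfold fRule
  rw [hSG, if_pos hr]

omit [DecidableEq α] [M.Finite] in
/-- A rank-`3` finset has at least `3` elements. -/
theorem three_le_card_of_eRk_eq_three {B : Finset α} (hr : M.eRk (B : Set α) = 3) : 3 ≤ B.card := by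
  have h := M.eRk_le_encard (B : Set α)
  rw [hr, Set.encard_coe_eq_coe_finsetCard] at h
  exact_mod_cast h

omit [DecidableEq α] [M.Finite] in
/-- A rank-`2` finset has at least `2` elements. -/
theorem two_le_card_of_eRk_eq_two {B : Finset α} (hr : M.eRk (B : Set α) = 2) : 2 ≤ B.card := by
  have h := M.eRk_le_encard (B : Set α)
  rw [hr, Set.encard_coe_eq_coe_finsetCard] at h
  exact_mod_cast h

omit [DecidableEq α] in
/-- A finset of the ground set with two distinct points has rank `≥ 2` (simple matroid), so rank `≤ 1` forces
`≤ 1` element. -/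
theorem card_le_one_of_eRk_le_one (hs : Simple M) {Q : Finset α} (hQ : Q ⊆ gr M)
    (hr : M.eRk (Q : Set α) ≤ 1) : Q.card ≤ 1 := by
  by_contra h
  push Not at h
  obtain ⟨a, ha, b, hb, hab⟩ := Finset.one_lt_card.1 h
  have := two_le_eRk_of_two_mem hs hQ ha hb hab
  have h2 : (2 : ℕ∞) ≤ 1 := this.trans hr
  exact absurd h2 (by decide)

omit [M.Finite] in
/-- The rank of `X ∪ {x}` is at most the rank of `X` plus one. -/
theorem eRk_insert_le_add_one (X : Finset α) (x : α) :
    M.eRk ((insert x X : Finset α) : Set α) ≤ M.eRk (X : Set α) + 1 := by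
  rw [Finset.coe_insert]
  exact M.eRk_insert_le_add_one x (X : Set α)

/-- The trace `P ∩ B` of a plane `P ≠ G` on a rank-`3` subset `B` of the plane `G` has rank `≤ 2`. -/
theorem eRk_inter_le_two {G P B : Finset α} (hG : G ∈ planes M) (hP : P ∈ planes M) (hne : P ≠ G)
    (hB : B ⊆ G) : M.eRk ((P ∩ B : Finset α) : Set α) ≤ 2 := by
  calc M.eRk ((P ∩ B : Finset α) : Set α) ≤ M.eRk ((P ∩ G : Finset α) : Set α) :=
        M.eRk_mono (Finset.coe_subset.2 (Finset.inter_subset_inter (Finset.Subset.refl P) hB))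
    _ ≤ 2 := eRk_inter_le_two_of_ne hP hG hne

/-- The line through a rank-`2` trace `P ∩ B` (`B ⊆ G` a plane, `P` a plane): `L := clF (P ∩ B)` is a line with
`L ∩ B = P ∩ B`, `L ⊆ G` and `L ⊆ P`. -/
theorem line_of_trace {G P B : Finset α} (hG : G ∈ planes M) (hP : P ∈ planes M) (hB : B ⊆ G)
    (hrB : M.eRk (B : Set α) = 3) (hr : M.eRk ((P ∩ B : Finset α) : Set α) = 2) :
    clF M (P ∩ B) ∈ lines M ∧ clF M (P ∩ B) ∩ B = P ∩ B ∧ clF M (P ∩ B) ⊆ G ∧ clF M (P ∩ B) ⊆ P := by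
  have hBg : B ⊆ gr M := hB.trans (mem_planes.1 hG).1
  have hPBg : P ∩ B ⊆ gr M := Finset.inter_subset_right.trans hBg
  obtain ⟨hL, hsub⟩ := clF_mem_lines hPBg hr
  have hLP : clF M (P ∩ B) ⊆ P := by
    rw [← Finset.coe_subset, coe_clF]
    have hPflat := (mem_planes.1 hP).2.1
    calc M.closure ((P ∩ B : Finset α) : Set α) ⊆ M.closure (P : Set α) :=
          M.closure_subset_closure (Finset.coe_subset.2 Finset.inter_subset_left)
      _ = (P : Set α) := hPflat.closure
  have hLG : clF M (P ∩ B) ⊆ G := by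
    rw [← Finset.coe_subset, coe_clF]
    calc M.closure ((P ∩ B : Finset α) : Set α) ⊆ M.closure (B : Set α) :=
          M.closure_subset_closure (Finset.coe_subset.2 Finset.inter_subset_right)
      _ = (G : Set α) := closure_eq_of_subset_plane hG hB hrB
  refine ⟨hL, ?_, hLG, hLP⟩
  apply Finset.Subset.antisymm
  · intro y hy
    rw [Finset.mem_inter] at hy ⊢
    exact ⟨hLP hy.1, hy.2⟩
  · intro y hy
    rw [Finset.mem_inter]
    exact ⟨hsub hy, (Finset.mem_inter.1 hy).2⟩

/-- A plane `P ≠ G` whose trace on `S = B ∪ {x}` has rank `3` (`B ⊆ G` of rank `3`, `x ∉ G`): the trace `P ∩ B` has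
rank exactly `2`, `x ∈ P`, and `|S ∩ P| ≤ |P ∩ B| + 1`. -/
theorem trace_single {G P B : Finset α} {x : α} (hG : G ∈ planes M) (hP : P ∈ planes M) (hne : P ≠ G)
    (hB : B ⊆ G) (hr3 : M.eRk (((insert x B) ∩ P : Finset α) : Set α) = 3) :
    M.eRk ((P ∩ B : Finset α) : Set α) = 2 ∧ x ∈ P ∧ ((insert x B) ∩ P).card ≤ (P ∩ B).card + 1 := by
  have hsub : (insert x B) ∩ P ⊆ insert x (P ∩ B) := by
    intro y hy
    rw [Finset.mem_inter, Finset.mem_insert] at hy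
    rw [Finset.mem_insert, Finset.mem_inter]
    rcases hy with ⟨rfl | hyB, hyP⟩
    · exact Or.inl rfl
    · exact Or.inr ⟨hyP, hyB⟩
  have hle2 := eRk_inter_le_two hG hP hne hB
  have hxP : x ∈ P := by
    by_contra hxP
    have heq : (insert x B) ∩ P = P ∩ B := by
      ext y
      rw [Finset.mem_inter, Finset.mem_insert, Finset.mem_inter]
      constructor
      · rintro ⟨rfl | hyB, hyP⟩
        · exact absurd hyP hxP
        · exact ⟨hyP, hyB⟩
      · rintro ⟨hyP, hyB⟩
        exact ⟨Or.inr hyB, hyP⟩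
    rw [heq] at hr3
    rw [hr3] at hle2
    exact absurd hle2 (by decide)
  obtain ⟨k, hk, -⟩ := eRk_eq_nat M (P ∩ B)
  have h3 : (3 : ℕ∞) ≤ M.eRk ((insert x (P ∩ B) : Finset α) : Set α) := by
    rw [← hr3]; exact M.eRk_mono (Finset.coe_subset.2 hsub)
  have h4 := (eRk_insert_le_add_one (M := M) (P ∩ B) x)
  have h34 := h3.trans h4
  rw [hk] at h34 hle2
  have hk2 : 2 ≤ k := by
    have : ((3 : ℕ) : ℕ∞) ≤ ((k + 1 : ℕ) : ℕ∞) := by push_cast; exact h34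
    have := (Nat.cast_le (α := ℕ∞)).1 this
    omega
  have hk2' : k ≤ 2 := by exact_mod_cast hle2
  refine ⟨?_, hxP, ?_⟩
  · rw [hk]; exact_mod_cast (le_antisymm hk2' hk2)
  · exact (Finset.card_le_card hsub).trans (Finset.card_insert_le _ _)

/-- `6^a ≤ 6^b` for `a ≤ b`. -/
theorem six_pow_le {a b : ℕ} (h : a ≤ b) : (6 : ℚ) ^ a ≤ (6 : ℚ) ^ b :=
  pow_le_pow_right₀ (by norm_num) h

/-- **The single-witness bound** (the inequality half of mine-2 §19.2 (a)): for `B ⊆ G` of rank `3` and `x ∉ G`,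
`D(B ∪ {x}) ≤ 6^{|B| − 3} + Λ(B)` — the planes of `M|(B ∪ {x})` other than `G` inject into the lines of `M|B` via
`P ↦ cl(P ∩ B)`, with `|S ∩ P| ≤ |P ∩ B| + 1`. -/
theorem D_single_le (hs : Simple M) {G B : Finset α} (hG : G ∈ planes M) (hB : B ⊆ G)
    (hr : M.eRk (B : Set α) = 3) {x : α} (hx : x ∈ gr M) (hxG : x ∉ G) :
    D M (insert x B) ≤ (6 : ℚ) ^ (B.card - 3) + Lam M B := by
  classical
  have hSG : (insert x B) ∩ G = B := by
    ext y
    rw [Finset.mem_inter, Finset.mem_insert]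
    constructor
    · rintro ⟨rfl | hyB, hyG⟩
      · exact absurd hyG hxG
      · exact hyB
    · intro hyB
      exact ⟨Or.inr hyB, hB hyB⟩
  unfold D
  rw [← Finset.add_sum_erase (planes M) _ hG, fRule_eq_of_inter hSG hr]
  apply add_le_add (le_refl _)
  set A := ((planes M).erase G).filter
    (fun P => M.eRk (((insert x B) ∩ P : Finset α) : Set α) = 3) with hA
  have hsum : ∑ P ∈ (planes M).erase G, fRule M P (insert x B) = ∑ P ∈ A, fRule M P (insert x B) := by
    rw [hA, Finset.sum_filter]
    apply Finset.sum_congr rfl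
    intro P _
    by_cases h : M.eRk (((insert x B) ∩ P : Finset α) : Set α) = 3
    · rw [if_pos h]
    · rw [if_neg h]
      unfold fRule
      rw [if_neg h]
  rw [hsum]
  -- the data of a plane in `A`
  have hAdata : ∀ P ∈ A, P ∈ planes M ∧ P ≠ G ∧ M.eRk ((P ∩ B : Finset α) : Set α) = 2 ∧ x ∈ P ∧
      ((insert x B) ∩ P).card ≤ (P ∩ B).card + 1 := by
    intro P hP
    rw [hA, Finset.mem_filter, Finset.mem_erase] at hP
    obtain ⟨⟨hne, hPpl⟩, hr3⟩ := hP
    obtain ⟨h2, hxP, hcard⟩ := trace_single hG hPpl hne hB hr3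
    exact ⟨hPpl, hne, h2, hxP, hcard⟩
  -- the line of a plane in `A`
  have hline : ∀ P ∈ A, clF M (P ∩ B) ∈ linesOf M B ∧ (clF M (P ∩ B) ∩ B).card = (P ∩ B).card ∧
      clF M (P ∩ B) ⊆ G ∧ clF M (P ∩ B) ⊆ P := by
    intro P hP
    obtain ⟨hPpl, hne, h2, -, -⟩ := hAdata P hP
    obtain ⟨hL, hLB, hLG, hLP⟩ := line_of_trace hG hPpl hB hr h2
    refine ⟨?_, by rw [hLB], hLG, hLP⟩
    unfold linesOf
    rw [Finset.mem_filter, hLB]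
    exact ⟨hL, two_le_card_of_eRk_eq_two h2⟩
  -- termwise bound
  have hterm : ∀ P ∈ A, fRule M P (insert x B) ≤ (6 : ℚ) ^ ((clF M (P ∩ B) ∩ B).card - 2) := by
    intro P hP
    obtain ⟨-, -, -, -, hcard⟩ := hAdata P hP
    obtain ⟨-, hLcard, -, -⟩ := hline P hP
    have hr3 : M.eRk (((insert x B) ∩ P : Finset α) : Set α) = 3 := by
      rw [hA, Finset.mem_filter] at hP; exact hP.2
    unfold fRule
    rw [if_pos hr3, hLcard]
    exact six_pow_le (by omega)
  -- injectivity of `P ↦ cl(P ∩ B)` on `A`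
  have hinj : Set.InjOn (fun P => clF M (P ∩ B)) (A : Set (Finset α)) := by
    intro P hP P' hP' hPP'
    simp only at hPP'
    obtain ⟨hPpl, -, -, hxP, -⟩ := hAdata P hP
    obtain ⟨hPpl', -, -, hxP', -⟩ := hAdata P' hP'
    obtain ⟨hL, -, hLG, hLP⟩ := hline P hP
    obtain ⟨-, -, -, hLP'⟩ := hline P' hP'
    rw [hPP'] at hLP hL hLG
    unfold linesOf at hL
    rw [Finset.mem_filter] at hL
    have hxL : x ∉ clF M (P' ∩ B) := fun h => hxG (hLG h)
    have hcard2 : 2 ≤ (clF M (P' ∩ B)).card :=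
      (hL.2).trans (Finset.card_le_card Finset.inter_subset_left)
    have hr3 : M.eRk ((insert x (clF M (P' ∩ B)) : Finset α) : Set α) = 3 :=
      eRk_insert_eq_three hs hL.1 (Finset.Subset.refl _) hcard2 hx hxL
    have hsubP : insert x (clF M (P' ∩ B)) ⊆ P := Finset.insert_subset hxP hLP
    have hsubP' : insert x (clF M (P' ∩ B)) ⊆ P' := Finset.insert_subset hxP' hLP'
    exact planes_eq_of_subset hPpl hPpl' hsubP hsubP' hr3
  calc ∑ P ∈ A, fRule M P (insert x B)
      ≤ ∑ P ∈ A, (6 : ℚ) ^ ((clF M (P ∩ B) ∩ B).card - 2) := Finset.sum_le_sum hterm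
    _ = ∑ L ∈ A.image (fun P => clF M (P ∩ B)), (6 : ℚ) ^ ((L ∩ B).card - 2) := by
        rw [Finset.sum_image hinj]
    _ ≤ ∑ L ∈ linesOf M B, (6 : ℚ) ^ ((L ∩ B).card - 2) := by
        apply Finset.sum_le_sum_of_subset_of_nonneg
        · intro L hL
          rw [Finset.mem_image] at hL
          obtain ⟨P, hP, rfl⟩ := hL
          exact (hline P hP).1
        · intro L _ _
          positivity
    _ = Lam M B := rfl

end SixThree

end PercRepro
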